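import Literature.AlgebraicTopology.Homotopy.PostnikovSection
import Literature.AlgebraicTopology.Homotopy.BasepointChangeMaps
import Literature.AlgebraicTopology.Homotopy.HomologyWeakEquivalence
import Literature.AlgebraicTopology.SingularHomology.RelativeHurewiczBoundary
import Literature.AlgebraicTopology.FundamentalGroup.SphereCoreComplementPi1
import HarnessLib

/-!
# Homology of a Postnikov section: `πₙ₊₁(X) ≃ Hₙ₊₂(Xₙ, X; ℤ)` and `Hᵢ(X) ≅ Hᵢ(Xₙ)` for `i ≤ n`

Topic `Literature/AlgebraicTopology/Homotopy`. The step of Serre's method (J.-P. Serre,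
*Homologie singulière des espaces fibrés*, Ann. of Math. 54 (1951), Ch. IV §3; A. Hatcher,
*Algebraic Topology* (2002), §4.1 p. 354, Thm. 4.32, §4.3 p. 410) that reads the next homotopy
group of a simply connected CW complex `X` off the relative homology of its Postnikov section
`X ↪ Xₙ` (`PostnikovSection.lean`: `Xₙ` is the telescope of killing steps, `incl_*` is a
bijection on `πₖ` for `k ≤ n`, onto for `k ≤ n + 1`, and `πₖ(Xₙ) = 0` for `k > n`): the pair
`(Xₙ, X)` is `(n+1)`-connected, so by the relative Hurewicz theorem `Hᵢ(Xₙ, X; ℤ) = 0` for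
`i ≤ n + 1` and `∂ : π_{n+2}(Xₙ, X) ≅ π_{n+1}(X)` with `π_{n+2}(Xₙ, X) ≃ H_{n+2}(Xₙ, X; ℤ)`
(`RelativeHurewiczBoundary.lean`). PROVED here, for a stage `S : Postnikov.Stage (n + 2)`
(a Hausdorff CW complex with cells of dimension `≤ n + 1`) with `S.X` simply connected:

* `SeqTelescope.isEmbedding_lvl` — each level `Xₖ ↪ T(f)` of a mapping telescope is an
  embedding (so `S.X ≃ₜ range incl`);
* `Postnikov.surjective_homotopyGroupMap_incl'`, `bijective_homotopyGroupMap_incl'` — the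
  statements (a) of `PostnikovSection.lean` at ALL base points (change of base point);
* `Postnikov.pathConnectedSpace_section`, `simplyConnectedSpace_section`, `simplyConnectedSpace_range`;
* `Postnikov.subsingleton_relHomotopyGroup` — `πₖ(Xₙ, X, a) = 0` for `2 ≤ k ≤ n + 1`;
* `Postnikov.isZero_relativeSingularHomology` — **`Hᵢ(Xₙ, X; ℤ) = 0` for `i ≤ n + 1`**;
* `Postnikov.nonempty_homotopyGroup_equiv` — **`π_{n+1}(X, x) ≃ H_{n+2}(Xₙ, X; ℤ)`**;
* `Postnikov.isIso_map_incl`, `epi_map_incl` — **`incl_* : Hᵢ(X; ℤ) ≅ Hᵢ(Xₙ; ℤ)` for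
  `i ≤ n`**, onto for `i = n + 1`.

Everything is proved; no named facts.

## References

* J.-P. Serre, *Homologie singulière des espaces fibrés. Applications*, Ann. of Math. (2) 54
  (1951), 425–505, Ch. IV §3. [Serre1951]
* A. Hatcher, *Algebraic Topology*, CUP (2002), §4.1 p. 354, Thm. 4.3, Thm. 4.32, §4.3 p. 410.
  [HatcherAT2002]
-/

noncomputable section

open Set Function Topology unitInterval CategoryTheory CategoryTheory.Limits
open scoped Topology.Homotopy unitInterval
open Literature.AlgebraicTopology.SingularHomology

universe u

namespace Literature.AlgebraicTopology.Homotopy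

/-! ### Levels of a telescope are embeddings -/

namespace SeqTelescope

variable {X : ℕ → Type u} [∀ n, TopologicalSpace (X n)] (f : ∀ n, C(X n, X (n + 1)))

/-- **Each level `x ↦ (n, x, 0)` of a mapping telescope is an embedding**: on the open slab of
heights `(n - ½, n + 1)` the level coordinate is a continuous left inverse. [folklore] -/
theorem isEmbedding_lvl (n : ℕ) : IsEmbedding (lvl f n) := by
  rcases isEmpty_or_nonempty (X n) with hX | ⟨⟨x₀⟩⟩
  · exact IsEmbedding.of_subsingleton _
  · have hmem : ∀ x : X n, lvl f n x ∈ slab f n := fun x => mk_mem_slab f x (by norm_num)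
    let l' : X n → slab f n := fun x => ⟨lvl f n x, hmem x⟩
    have hl' : Continuous l' := (lvl f n).continuous.subtype_mk hmem
    have hg : Continuous ((slab f n).restrict (levelCoord f n x₀)) :=
      continuousOn_iff_continuous_restrict.1 (continuousOn_levelCoord f n x₀)
    have hgl : (slab f n).restrict (levelCoord f n x₀) ∘ l' = id :=
      funext fun x => levelCoord_mk_of_lt_one f n x₀ x (t := 0) (by norm_num)
    have hind : IsInducing l' := IsInducing.of_comp hl' hg (by rw [hgl]; exact IsInducing.id)
    exact ⟨IsInducing.subtypeVal.comp hind, lvl_injective (f := f) n⟩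

/-- A point of the telescope is joined to its shift `adv (z, 1)` into the next cylinder. [folklore] -/
theorem joined_adv_one (z : SeqTelescope f) : Joined z (adv f (z, 1)) :=
  ⟨{ toFun := fun s => adv f (z, s)
     continuous_toFun := (adv f).continuous.comp (continuous_const.prodMk continuous_id)
     source' := adv_zero f z
     target' := rfl }⟩

/-- `(0, x, 0)` is joined to `(j, through j x, 0)` in the telescope. [folklore] -/
theorem joined_lvl_zero_lvl_through (x : X 0) (j : ℕ) : Joined (lvl f 0 x) (lvl f j (through f j x)) := by
  induction j with
  | zero => exact Joined.refl _
  | succ j ih =>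
    refine ih.trans ?_
    have h := joined_adv_one f (lvl f j (through f j x))
    rwa [lvl_apply, adv_one] at h

/-- `(n, x, t)` is joined to the bottom `(n, x, 0)` of its cylinder. [folklore] -/
theorem joined_mk_lvl (n : ℕ) (x : X n) (t : I) : Joined (mk f n x t) (lvl f n x) := by
  refine Joined.symm ⟨?_⟩
  exact
    { toFun := fun s => mk f n x (s * t)
      continuous_toFun := (continuous_mk f n).comp (continuous_const.prodMk (continuous_id.mul continuous_const))
      source' := by simp only [zero_mul]; rfl
      target' := by simp only [one_mul] }

end SeqTelescope

namespace Postnikov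

variable (n : ℕ) (S : Stage.{u} (n + 2))

/-! ### The base `X ⊂ Xₙ` as a subspace -/

/-- **`incl : X ↪ Xₙ` is an embedding** (so `(isEmbedding_incl n S).toHomeomorph : X ≃ₜ incl(X)`).
[folklore] -/
theorem isEmbedding_incl : IsEmbedding (incl n S) :=
  SeqTelescope.isEmbedding_lvl (maps n S) 0

/-- `incl = val ∘ e` for the homeomorphism `e : X ≃ₜ incl(X)` of the embedding `incl`. [folklore] -/
theorem subsetIncl_comp_toHomeomorph :
    (subsetIncl (range (incl n S))).comp
        ((isEmbedding_incl n S).toHomeomorph : C(S.X, range (incl n S))) = incl n S :=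
  ContinuousMap.ext fun _ => rfl

/-- `incl_* = i_* ∘ e_*` on homotopy groups, `e : X ≃ₜ incl(X)`. [folklore] -/
theorem homotopyGroupIncl_comp {N : Type} (x : S.X) :
    homotopyGroupIncl (N := N) (range (incl n S)) ((isEmbedding_incl n S).toHomeomorph x) ∘
        homotopyGroupMap (N := N)
          ((isEmbedding_incl n S).toHomeomorph : C(S.X, range (incl n S))) x =
      homotopyGroupMap (N := N) (incl n S) x := by
  funext α
  induction α using Quotient.inductionOn with
  | h p => exact congrArg (Quotient.mk _) (GenLoop.ext _ _ fun _ => rfl)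

/-! ### `0`-cells of the tower come from `0`-cells of `X`; path-connectedness of the section -/

/-- Every `0`-cell of stage `j` is `through j x` for a `0`-cell `x` of `X`. [folklore] -/
theorem exists_eq_through_of_mem_skeletonLT_one (j : ℕ) {y : (tower n S j).X}
    (hy : y ∈ (RelCWComplex.skeletonLT (univ : Set (tower n S j).X) (1 : ℕ) : Set (tower n S j).X)) :
    ∃ x : S.X, x ∈ (RelCWComplex.skeletonLT (univ : Set S.X) (1 : ℕ) : Set S.X) ∧
      SeqTelescope.through (maps n S) j x = y := by
  induction j with
  | zero => exact ⟨y, hy, rfl⟩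
  | succ j ih =>
    obtain ⟨x', hx', rfl⟩ := exists_eq_maps_of_mem_skeletonLT_one n S j hy
    obtain ⟨x, hx, rfl⟩ := ih hx'
    exact ⟨x, hx, rfl⟩

/-- Every point of the section is joined to a point of `incl(X)`. [folklore] -/
theorem exists_joined_incl (z : Section n S) : ∃ x : S.X, Joined z (incl n S x) := by
  induction z using SeqTelescope.ind with
  | h j y t =>
    have h1 := SeqTelescope.joined_mk_lvl (maps n S) j y t
    obtain ⟨y₀, hy₀, hyy₀⟩ := exists_joined_zeroCell y
    obtain ⟨γ⟩ := hyy₀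
    have h2 : Joined (SeqTelescope.lvl (maps n S) j y) (SeqTelescope.lvl (maps n S) j y₀) :=
      ⟨γ.map (SeqTelescope.lvl (maps n S) j).continuous⟩
    obtain ⟨x, -, rfl⟩ := exists_eq_through_of_mem_skeletonLT_one n S j hy₀
    exact ⟨x, (h1.trans h2).trans (SeqTelescope.joined_lvl_zero_lvl_through (maps n S) x j).symm⟩

/-- **The section of a path-connected stage is path-connected.** [folklore] -/
theorem pathConnectedSpace_section [PathConnectedSpace S.X] : PathConnectedSpace (Section n S) := by
  obtain ⟨x₀⟩ : Nonempty S.X := inferInstance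
  refine ⟨⟨incl n S x₀⟩, fun z w => ?_⟩
  obtain ⟨x, hx⟩ := exists_joined_incl n S z
  obtain ⟨y, hy⟩ := exists_joined_incl n S w
  obtain ⟨γ⟩ := PathConnectedSpace.joined (X := S.X) x y
  exact (hx.trans ⟨γ.map (incl n S).continuous⟩).trans hy.symm

/-! ### (a) at all base points -/

/-- **`incl_* : πₖ(X, x) → πₖ(Xₙ, incl x)` is onto for `1 ≤ k ≤ n + 1` at EVERY base point.**
[cite: HatcherAT2002, §4.1 p. 354 (a), p. 342] -/
theorem surjective_homotopyGroupMap_incl' {k : ℕ} [NeZero k] (hk : k ≤ n + 1) (x : S.X) :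
    Surjective (homotopyGroupMap (N := Fin k) (incl n S) x) :=
  BasepointChange.surjective_homotopyGroupMap_of_zeroCells _
    (fun y hy => surjective_homotopyGroupMap_incl n S hk y hy) x

/-- **`incl_* : πₖ(X, x) → πₖ(Xₙ, incl x)` is a bijection for `1 ≤ k ≤ n` at EVERY base point.**
[cite: HatcherAT2002, §4.1 p. 354 (a), p. 342] -/
theorem bijective_homotopyGroupMap_incl' {k : ℕ} [NeZero k] (hk : k ≤ n) (x : S.X) :
    Bijective (homotopyGroupMap (N := Fin k) (incl n S) x) :=
  BasepointChange.bijective_homotopyGroupMap_of_zeroCells _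
    (fun y hy => bijective_homotopyGroupMap_incl n S hk y hy) x

/-- `i_* : πₖ(incl X, a) → πₖ(Xₙ, a)` is onto for `1 ≤ k ≤ n + 1`, every `a`. [cite: HatcherAT2002, §4.1 p. 354 (a)] -/
theorem surjective_homotopyGroupIncl_range {k : ℕ} [NeZero k] (hk : k ≤ n + 1) (a : range (incl n S)) :
    Surjective (homotopyGroupIncl (N := Fin k) (range (incl n S)) a) := by
  obtain ⟨x, rfl⟩ := (isEmbedding_incl n S).toHomeomorph.surjective a
  have h := surjective_homotopyGroupMap_incl' n S hk x
  rw [← homotopyGroupIncl_comp n S x] at h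
  exact Surjective.of_comp h

/-- `i_* : πₖ(incl X, a) → πₖ(Xₙ, a)` is one-to-one for `1 ≤ k ≤ n`, every `a`, over any index
type of cardinality `k`. [cite: HatcherAT2002, §4.1 p. 354 (a)] -/
theorem injective_homotopyGroupIncl_range {N : Type} {k : ℕ} [NeZero k] (e : N ≃ Fin k)
    (hk : k ≤ n) (a : range (incl n S)) : Injective (homotopyGroupIncl (N := N) (range (incl n S)) a) := by
  obtain ⟨x, rfl⟩ := (isEmbedding_incl n S).toHomeomorph.surjective a
  rw [homotopyGroupIncl, injective_homotopyGroupMap_iff_of_equiv e]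
  have h := (bijective_homotopyGroupMap_incl' n S hk x).1
  rw [← homotopyGroupIncl_comp n S x] at h
  exact Injective.of_comp_right h
    (bijective_homotopyGroupMap_homeomorph (isEmbedding_incl n S).toHomeomorph x).2

/-! ### The pair `(Xₙ, X)` is `(n+1)`-connected -/

/-- **Exactness criterion**: `π_N(X, A, a)` is trivial when `i_*` is onto on `π_N` and one-to-one
on `π_{N∖i}` (Hatcher Thm. 4.3). [cite: HatcherAT2002, Thm. 4.3] -/
theorem subsingleton_relHomotopyGroup_of_exact {Y : Type*} [TopologicalSpace Y] {N : Type*} [DecidableEq N]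
    {i : N} {A : Set Y} {a : A} (hs : Surjective (homotopyGroupIncl (N := N) A a))
    (hi : Injective (homotopyGroupIncl (N := { j // j ≠ i }) A a)) :
    Subsingleton (RelHomotopyGroup i Y A a) := by
  have hconst : homotopyGroupIncl (N := { j // j ≠ i }) A a ⟦GenLoop.const⟧ = ⟦GenLoop.const⟧ :=
    congrArg (Quotient.mk _) (GenLoop.ext _ _ fun _ => rfl)
  have key : ∀ c : RelHomotopyGroup i Y A a, c = default := fun c => by
    have h1 : RelHomotopyGroup.boundary c = ⟦GenLoop.const⟧ :=
      hi ((RelHomotopyGroup.homotopyGroupIncl_boundary c).trans hconst.symm)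
    obtain ⟨b, rfl⟩ := RelHomotopyGroup.exists_ofAbsolute_eq c h1
    obtain ⟨b', rfl⟩ := hs b
    exact RelHomotopyGroup.ofAbsolute_homotopyGroupIncl b'
  exact ⟨fun c d => (key c).trans (key d).symm⟩

/-- **`πₖ(Xₙ, X, a) = 0` for `2 ≤ k ≤ n + 1`**: the pair `(Xₙ, X)` is `(n+1)`-connected
(exactness, with `incl_*` onto on `πₖ`, `k ≤ n + 1`, and one-to-one on `πₖ₋₁`, `k - 1 ≤ n`).
[cite: HatcherAT2002, §4.1 p. 354, Thm. 4.3] -/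
theorem subsingleton_relHomotopyGroup {k : ℕ} [NeZero k] (hk2 : 2 ≤ k) (hk : k ≤ n + 1)
    (a : range (incl n S)) : Subsingleton (RelHomotopyGroup.Pi k (Section n S) (range (incl n S)) a) := by
  obtain ⟨k, rfl⟩ : ∃ k', k = k' + 1 := ⟨k - 1, by omega⟩
  haveI : NeZero k := ⟨by omega⟩
  exact subsingleton_relHomotopyGroup_of_exact (surjective_homotopyGroupIncl_range n S hk a)
    (injective_homotopyGroupIncl_range n S (finSuccAboveEquiv (0 : Fin (k + 1))).symm (by omega) a)

/-! ### Simple connectivity -/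

/-- **The section of a simply connected stage is simply connected** (`incl_*` onto on `π₁`).
[cite: HatcherAT2002, §4.1 p. 354] -/
theorem simplyConnectedSpace_section [SimplyConnectedSpace S.X] : SimplyConnectedSpace (Section n S) := by
  haveI := pathConnectedSpace_section n S
  obtain ⟨x₀⟩ : Nonempty S.X := inferInstance
  haveI : Subsingleton (π_ 1 S.X x₀) :=
    (HomotopyGroup.pi1EquivFundamentalGroup : π_ 1 S.X x₀ ≃ FundamentalGroup S.X x₀).subsingleton
  haveI : Subsingleton (HomotopyGroup (Fin 1) (tower n S 0).X x₀) := ‹Subsingleton (π_ 1 S.X x₀)›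
  haveI : Subsingleton (π_ 1 (Section n S) (incl n S x₀)) :=
    (surjective_homotopyGroupMap_incl' n S (k := 1) (by omega) x₀).subsingleton
  haveI : Subsingleton (FundamentalGroup (Section n S) (incl n S x₀)) :=
    (homotopyGroupEquivFundamentalGroupOfUnique (X := Section n S) (x := incl n S x₀) (Fin 1)).symm.subsingleton
  exact Literature.AlgebraicTopology.FundamentalGroup.VanKampen.simplyConnectedSpace_of_subsingleton (incl n S x₀)

/-- **`incl(X)` is simply connected** (homeomorphic to `X`). [folklore] -/
theorem simplyConnectedSpace_range [SimplyConnectedSpace S.X] : SimplyConnectedSpace (range (incl n S)) := by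
  haveI : PathConnectedSpace (range (incl n S)) :=
    isPathConnected_iff_pathConnectedSpace.1 (isPathConnected_range (incl n S).continuous)
  obtain ⟨x₀⟩ : Nonempty S.X := inferInstance
  set e := (isEmbedding_incl n S).toHomeomorph
  haveI : Subsingleton (π_ 1 S.X x₀) :=
    (HomotopyGroup.pi1EquivFundamentalGroup : π_ 1 S.X x₀ ≃ FundamentalGroup S.X x₀).subsingleton
  haveI : Subsingleton (π_ 1 (range (incl n S)) (e x₀)) :=
    (bijective_homotopyGroupMap_homeomorph (N := Fin 1) e x₀).2.subsingleton
  haveI : Subsingleton (FundamentalGroup (range (incl n S)) (e x₀)) :=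
    (homotopyGroupEquivFundamentalGroupOfUnique (X := range (incl n S)) (x := e x₀) (Fin 1)).symm.subsingleton
  exact Literature.AlgebraicTopology.FundamentalGroup.VanKampen.simplyConnectedSpace_of_subsingleton (e x₀)

/-! ### The theorems -/

/-- **`Hᵢ(Xₙ, X; ℤ) = 0` for `i ≤ n + 1`** (relative Hurewicz for the `(n+1)`-connected pair
`(Xₙ, X)` of simply connected spaces). [cite: HatcherAT2002, §4.1 p. 354, Thm. 4.32] -/
theorem isZero_relativeSingularHomology [SimplyConnectedSpace S.X] {i : ℕ} (hi : i ≤ n + 1) :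
    IsZero (relativeSingularHomology ℤ ℤ (Section n S) (range (incl n S)) i) := by
  haveI := simplyConnectedSpace_section n S
  haveI := simplyConnectedSpace_range n S
  exact RelativeHurewiczBoundary.isZero_relativeSingularHomology n
    (fun k _ hk2 hk a => subsingleton_relHomotopyGroup n S hk2 hk a) hi

/-- **`πₙ₊₁(X, x) ≃ Hₙ₊₂(Xₙ, X; ℤ)`** for a simply connected Hausdorff CW complex `X` with cells
of dimension `≤ n + 1` and its Postnikov section `Xₙ` (Serre's method: `π_{n+2}(Xₙ) =
π_{n+1}(Xₙ) = 0`, so `∂ : π_{n+2}(Xₙ, X) ≅ π_{n+1}(X)`, and relative Hurewicz).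
[cite: Serre1951, Ch. IV §3; HatcherAT2002, Thm. 4.32, §4.3 p. 410] -/
theorem nonempty_homotopyGroup_equiv [SimplyConnectedSpace S.X] (x : S.X) :
    Nonempty (π_ (n + 1) S.X x ≃ relativeSingularHomology ℤ ℤ (Section n S) (range (incl n S)) (n + 2)) := by
  haveI := simplyConnectedSpace_section n S
  haveI := simplyConnectedSpace_range n S
  set e := (isEmbedding_incl n S).toHomeomorph
  have h₂ : Subsingleton (HomotopyGroup (Fin (n + 2)) (Section n S) (incl n S x)) :=
    subsingleton_homotopyGroup n S (by omega) _
  have h₁ : Subsingleton (HomotopyGroup { j : Fin (n + 2) // j ≠ 0 } (Section n S) (incl n S x)) :=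
    haveI := subsingleton_homotopyGroup n S (k := n + 1) (by omega) (incl n S x)
    (homotopyGroupCongr (X := Section n S) (x := incl n S x) (finSuccAboveEquiv (0 : Fin (n + 2))).symm).subsingleton
  obtain ⟨e1⟩ := RelativeHurewiczBoundary.nonempty_equiv (X := Section n S) (A := range (incl n S)) n
    (e x) (fun k _ hk2 hk a => subsingleton_relHomotopyGroup n S hk2 hk a) h₂ h₁
  exact ⟨((Equiv.ofBijective _ (bijective_homotopyGroupMap_homeomorph (N := Fin (n + 1)) e x)).trans
    (homotopyGroupCongr (finSuccAboveEquiv (0 : Fin (n + 2))).symm).symm).trans e1⟩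

/-- **`incl_* : Hᵢ(X; ℤ) ≅ Hᵢ(Xₙ; ℤ)` for `i ≤ n`** (exact sequence of the pair with
`Hᵢ(Xₙ, X) = Hᵢ₊₁(Xₙ, X) = 0`). [cite: HatcherAT2002, §4.1 p. 354, Thm. 4.32; Serre1951, Ch. IV §3] -/
theorem isIso_map_incl [SimplyConnectedSpace S.X] {i : ℕ} (hi : i ≤ n) :
    IsIso (singularHomology.map ℤ ℤ (incl n S) i) := by
  have h0 := isZero_relativeSingularHomology n S (i := i) (by omega)
  have h1 := isZero_relativeSingularHomology n S (i := i + 1) (by omega)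
  haveI : Mono (singularHomology.map ℤ ℤ (subsetIncl (range (incl n S))) i) :=
    (relativeSingularHomology.exact_δ_map ℤ ℤ (range (incl n S)) i).mono_g (h1.eq_of_src _ _)
  haveI : Epi (singularHomology.map ℤ ℤ (subsetIncl (range (incl n S))) i) :=
    (relativeSingularHomology.exact_map_ofAbsolute ℤ ℤ (range (incl n S)) i).epi_f (h0.eq_of_tgt _ _)
  haveI : IsIso (singularHomology.map ℤ ℤ (subsetIncl (range (incl n S))) i) := isIso_of_mono_of_epi _
  haveI : IsIso (singularHomology.map ℤ ℤ
      ((isEmbedding_incl n S).toHomeomorph : C(S.X, range (incl n S))) i) :=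
    inferInstanceAs (IsIso (singularHomology.mapIso ℤ ℤ (isEmbedding_incl n S).toHomeomorph i).hom)
  rw [← subsetIncl_comp_toHomeomorph, singularHomology.map_comp]
  infer_instance

/-- **`incl_* : Hᵢ(X; ℤ) → Hᵢ(Xₙ; ℤ)` is onto for `i ≤ n + 1`** (`Hᵢ(Xₙ, X) = 0`).
[cite: HatcherAT2002, §4.1 p. 354, Thm. 4.32] -/
theorem epi_map_incl [SimplyConnectedSpace S.X] {i : ℕ} (hi : i ≤ n + 1) :
    Epi (singularHomology.map ℤ ℤ (incl n S) i) := by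
  have h0 := isZero_relativeSingularHomology n S (i := i) hi
  haveI : Epi (singularHomology.map ℤ ℤ (subsetIncl (range (incl n S))) i) :=
    (relativeSingularHomology.exact_map_ofAbsolute ℤ ℤ (range (incl n S)) i).epi_f (h0.eq_of_tgt _ _)
  haveI : IsIso (singularHomology.map ℤ ℤ
      ((isEmbedding_incl n S).toHomeomorph : C(S.X, range (incl n S))) i) :=
    inferInstanceAs (IsIso (singularHomology.mapIso ℤ ℤ (isEmbedding_incl n S).toHomeomorph i).hom)
  rw [← subsetIncl_comp_toHomeomorph, singularHomology.map_comp]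
  infer_instance

end Postnikov

end Literature.AlgebraicTopology.Homotopy

end
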